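import Literature.NumberTheory.LocalFields.QuadraticOrderRegularRepShells   -- ★ p843859 (F0P3a-p08): `forall_v_shellConj_sub_le`, `diagonal_inv_mul_regRep_mul_diagonal`
import HarnessLib

/-!
# Deep shells of a quadratic torus element are level-`j` trivial — road «W′» = «R1LL-WILD», brick (Ψ2) «DEEP SHELLS VANISH IN `O(t) − O(e t)`»
# (Labesse–Langlands 1979 §2 (2.2); Labesse 2024 Prop. 0.0.11 «on peut prendre ε = 0 si b est assez petit» — the ALGEBRA, place-blind, dyadic-safe)

Topic `NumberTheory/LocalFields`; namespace `Literature.NumberTheory.LocalFields.QuadraticRegularRep` (continues ★ p843859's tokens `!![a, b * v; b, a + b * u]`,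
shell-`m` conjugate `!![a, b * v * ϖ ^ m; b * (ϖ ^ m)⁻¹, a + b * u]`).  THEOREMS ONLY (no definition, no instance, no notation, no named fact, no `sorry`).
Cell `pub/hodgecm-mathlib` (D-0151), crux H413 = `stmt-HodgeConjecture-24833`; architect A-p16 (g28) RULINGS A-37 (display of record = A-p12 (g19) (W′0) md 135db401 §D)
and A-38 (c) (this brick → A-p12); census `F0/P3a/A-p12/g19/CENSUS-Psi2-DeepShellsVanish.A-p12g19.md` 77802090.  HONEST LABEL: HC_CM is proved only modulo the printed
citations (2 remaining named inputs hLiu418, h413) until rung 0 closes; nothing printed is asserted here beyond elementary valuation estimates on explicit `2 × 2` matrices.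

THE CONTENT (LL79 p. 9 «`f(a, b²v∕x; x, a + bu) = f(a₀, 0; x, a₀)` for `b` small»; Labesse2024 Prop. 0.0.11).  In the unstable difference `O(t,φ) − O(e t,φ)` unfolded into the
`T̃`-shells of the tree (shell `i` ↔ representative `diag(1, ϖ^i)`, `2q^i` vertices; partner `e t = η₁⁻¹ t η₁` with `η₁` a UNIT diagonal similitude), the shell-`i` PAIR consists of
the shell conjugate `(a, b v ϖ^i; b ϖ^{−i}, a + b u)` of `γ = a + bτ` and its conjugate by a unit diagonal matrix.  On a DEEP shell — `|b ϖ^{−i}| ≤ |ϖ|^j`, `j` the level of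
`φ` — BOTH lie in the level-`j` cell `{M | |M − a•1| ≤ |ϖ|^j entrywise}` around the scalar `a•1`, so a test function constant on such cells takes the SAME value on both and the
pair difference is `0`: the deep shells contribute nothing, conductor-free, tame and wild alike (the window `ord b − j < i ≤ ord b` is (Ψ3)'s).

* §1 `forall_v_shellConj_sub_smul_one_le` — the deep shell conjugate is `≡ a•1 (mod ϖ^j)` entrywise (= ★ `forall_v_shellConj_sub_le` at `(a′, b′) := (a, 0)`);
  `v_mul_inv_pow_le_of_le` — the bookkeeping `|b| ≤ |ϖ|^(i+j) ⇒ |b ϖ^{−i}| ≤ |ϖ|^j` (shell `i` is deep iff `i + j ≤ ord b`).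
* §2 `forall_v_diagonal_conj_sub_smul_one_le` — conjugation by a diagonal matrix with UNIT entries preserves `|M − a•1| ≤ c` entrywise (the partner's outer twist).
* §3 the PAIR heads: `apply_shellConj_eq_apply_smul_one_of_deep`, `apply_diagonal_conj_shellConj_eq_apply_smul_one_of_deep` (both values = `φ (a•1)`) and
  `apply_shellConj_sub_apply_diagonal_conj_shellConj_eq_zero_of_deep` (the shell-`i` pair difference vanishes) for any `φ` constant on level-`j` cells around `a•1`.

## References
* [LabesseLanglands1979] J.-P. Labesse, R. P. Langlands, *L-indistinguishability for SL(2)*, Canad. J. Math. 31 (1979) 726–785: §2 (2.1)–(2.2), pp. 8–9.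
* [Labesse2024StabilisationGermesSL2] J.-P. Labesse, *Stabilisation et germes pour SL(2) en toutes caractéristiques*, arXiv:2411.14820 v2 (2025): Prop. 0.0.10, Prop. 0.0.11, Th. 0.0.12.
* [Rogawski1990] J. D. Rogawski, *Automorphic Representations of Unitary Groups in Three Variables*, Ann. of Math. Stud. 123 (1990): §4.9 Lemma 4.9.3 p. 56.
-/

set_option autoImplicit false

open Matrix

namespace Literature.NumberTheory.LocalFields.QuadraticRegularRep

section Valued

variable {K : Type*} [Field K] {Γ₀ : Type*} [LinearOrderedCommGroupWithZero Γ₀] [hK : Valued K Γ₀]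

/-! ## §1 The deep shell conjugate is congruent to the scalar `a•1` -/

/-- The regular-representation matrix at `b = 0`, read at any shell, is the scalar matrix `a • 1`. [cite: LabesseLanglands1979, §2 (2.1) p. 8] -/
theorem shellConj_zero_eq_smul_one (u v ϖ : K) (m : ℕ) (a : K) :
    !![a, 0 * v * ϖ ^ m; 0 * (ϖ ^ m)⁻¹, a + 0 * u] = a • (1 : Matrix (Fin 2) (Fin 2) K) := by
  ext i k
  fin_cases i <;> fin_cases k <;> simp

/-- **DEEP SHELLS ARE LEVEL-`j` TRIVIAL.**  If `u, v` are integral, `0 < |ϖ| ≤ 1` and `|b (ϖ^m)⁻¹| ≤ |ϖ|^j` (the shell `m` is DEEP for `γ = a + bτ` at level `j`), then the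
shell-`m` conjugate `(a, b v ϖ^m; b ϖ^{−m}, a + b u)` is congruent to the scalar matrix `a • 1` modulo `ϖ^j` ENTRYWISE — LL79 p. 9 «`f(a, b²v∕x; x, a+bu) = f(a₀, 0; x, a₀)`»,
Labesse 2024 Prop. 0.0.11 «ε = 0 si `b` est assez petit». [cite: LabesseLanglands1979, §2 (2.2) p. 9] [cite: Labesse2024StabilisationGermesSL2, Prop. 0.0.11] -/
theorem forall_v_shellConj_sub_smul_one_le (u v : K) (hu : Valued.v u ≤ 1) (hv : Valued.v v ≤ 1) (ϖ : K) (hϖ0 : ϖ ≠ 0) (hϖ : Valued.v ϖ ≤ 1)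
    (m j : ℕ) (a b : K) (hb : Valued.v (b * (ϖ ^ m)⁻¹) ≤ Valued.v ϖ ^ j) :
    ∀ i k, Valued.v (!![a, b * v * ϖ ^ m; b * (ϖ ^ m)⁻¹, a + b * u] i k - (a • (1 : Matrix (Fin 2) (Fin 2) K)) i k) ≤ Valued.v ϖ ^ j := by
  have h := forall_v_shellConj_sub_le u v hu hv ϖ hϖ0 hϖ m j a b a 0 (by simp) (by simpa using hb)
  rw [shellConj_zero_eq_smul_one] at h
  exact h

/-- Bookkeeping: `|b| ≤ |ϖ|^(m + j)` (i.e. `m + j ≤ ord b`: the shell `m` is deep at level `j`) gives the hypothesis `|b (ϖ^m)⁻¹| ≤ |ϖ|^j` of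
`forall_v_shellConj_sub_smul_one_le`. [cite: LabesseLanglands1979, §2 p. 8] -/
theorem v_mul_inv_pow_le_of_le (ϖ : K) (hϖ0 : ϖ ≠ 0) (m j : ℕ) (b : K) (hb : Valued.v b ≤ Valued.v ϖ ^ (m + j)) :
    Valued.v (b * (ϖ ^ m)⁻¹) ≤ Valued.v ϖ ^ j := by
  have hm0 : Valued.v (ϖ ^ m) ≠ 0 := by
    rw [map_pow]; exact pow_ne_zero m ((Valuation.ne_zero_iff _).2 hϖ0)
  rw [map_mul, map_inv₀, mul_inv_le_iff₀ (zero_lt_iff.2 hm0), map_pow, ← pow_add, add_comm j m]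
  exact hb

/-- Conversely-oriented bookkeeping: `|b (ϖ^m)⁻¹| ≤ |ϖ|^j` implies `|b| ≤ |ϖ|^(m + j)`. [cite: LabesseLanglands1979, §2 p. 8] -/
theorem v_le_pow_add_of_v_mul_inv_pow_le (ϖ : K) (hϖ0 : ϖ ≠ 0) (m j : ℕ) (b : K) (hb : Valued.v (b * (ϖ ^ m)⁻¹) ≤ Valued.v ϖ ^ j) :
    Valued.v b ≤ Valued.v ϖ ^ (m + j) := by
  have hm0 : Valued.v (ϖ ^ m) ≠ 0 := by
    rw [map_pow]; exact pow_ne_zero m ((Valuation.ne_zero_iff _).2 hϖ0)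
  rw [map_mul, map_inv₀, mul_inv_le_iff₀ (zero_lt_iff.2 hm0), map_pow, ← pow_add, add_comm j m] at hb
  exact hb

/-! ## §2 The partner's outer twist: conjugation by a unit diagonal matrix -/

/-- Entries of `diag(r₀⁻¹, r₁⁻¹)·M·diag(r₀, r₁)`: the `(i,k)` entry is `r_i⁻¹ · M i k · r_k`. [cite: LabesseLanglands1979, §2 p. 8] -/
theorem diagonal_inv_mul_mul_diagonal_apply (r₀ r₁ : K) (M : Matrix (Fin 2) (Fin 2) K) (i k : Fin 2) :
    (Matrix.diagonal ![r₀⁻¹, r₁⁻¹] * M * Matrix.diagonal ![r₀, r₁]) i k = (![r₀⁻¹, r₁⁻¹] i) * M i k * (![r₀, r₁] k) := by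
  rw [Matrix.mul_apply]
  simp only [Matrix.diagonal_mul, Matrix.diagonal_apply]
  rw [Finset.sum_eq_single k]
  · simp
  · intro x _ hx
    simp [hx]
  · intro hk
    exact absurd (Finset.mem_univ k) hk

/-- Conjugating the scalar matrix `a • 1` by `diag(r₀, r₁)` (`r₀, r₁ ≠ 0`) gives back `a • 1`. [cite: LabesseLanglands1979, §2 p. 8] -/
theorem diagonal_inv_mul_smul_one_mul_diagonal (r₀ r₁ : K) (h0 : r₀ ≠ 0) (h1 : r₁ ≠ 0) (a : K) :
    Matrix.diagonal ![r₀⁻¹, r₁⁻¹] * (a • (1 : Matrix (Fin 2) (Fin 2) K)) * Matrix.diagonal ![r₀, r₁] = a • (1 : Matrix (Fin 2) (Fin 2) K) := by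
  ext i k
  rw [diagonal_inv_mul_mul_diagonal_apply]
  fin_cases i <;> fin_cases k <;> simp
  · rw [mul_right_comm, inv_mul_cancel₀ h0, one_mul]
  · rw [mul_right_comm, inv_mul_cancel₀ h1, one_mul]

/-- **THE OUTER TWIST PRESERVES LEVEL CELLS.**  If `|r₀| = |r₁| = 1` and `|M i k − (a•1) i k| ≤ c` for all entries, then the same bound holds for the conjugate
`diag(r₀⁻¹, r₁⁻¹)·M·diag(r₀, r₁)` — the partner `e t = η₁⁻¹ t η₁` of the unstable pair (`η₁` a unit diagonal similitude, [Rogawski1990 §4.9]) reads the SAME level-`j`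
cell at every deep shell. [cite: LabesseLanglands1979, §2 (2.2) p. 9] [cite: Rogawski1990, §4.9 Lemma 4.9.3 p. 56] -/
theorem forall_v_diagonal_conj_sub_smul_one_le (r₀ r₁ : K) (h0 : Valued.v r₀ = 1) (h1 : Valued.v r₁ = 1)
    (M : Matrix (Fin 2) (Fin 2) K) (a : K) (c : Γ₀) (h : ∀ i k, Valued.v (M i k - (a • (1 : Matrix (Fin 2) (Fin 2) K)) i k) ≤ c) :
    ∀ i k, Valued.v ((Matrix.diagonal ![r₀⁻¹, r₁⁻¹] * M * Matrix.diagonal ![r₀, r₁]) i k - (a • (1 : Matrix (Fin 2) (Fin 2) K)) i k) ≤ c := by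
  have hr0 : r₀ ≠ 0 := fun h' => by rw [h', map_zero] at h0; exact zero_ne_one h0
  have hr1 : r₁ ≠ 0 := fun h' => by rw [h', map_zero] at h1; exact zero_ne_one h1
  intro i k
  -- `(D⁻¹ M D − a•1) i k = r_i⁻¹ · (M − a•1) i k · r_k`, and `|r_i⁻¹| = |r_k| = 1`
  have hs_rev : (![r₀⁻¹, r₁⁻¹] i) * (a • (1 : Matrix (Fin 2) (Fin 2) K)) i k * (![r₀, r₁] k) = (a • (1 : Matrix (Fin 2) (Fin 2) K)) i k := by
    fin_cases i <;> fin_cases k <;> simp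
    · rw [mul_right_comm, inv_mul_cancel₀ hr0, one_mul]
    · rw [mul_right_comm, inv_mul_cancel₀ hr1, one_mul]
  have hconj : (Matrix.diagonal ![r₀⁻¹, r₁⁻¹] * M * Matrix.diagonal ![r₀, r₁]) i k - (a • (1 : Matrix (Fin 2) (Fin 2) K)) i k =
      (![r₀⁻¹, r₁⁻¹] i) * (M i k - (a • (1 : Matrix (Fin 2) (Fin 2) K)) i k) * (![r₀, r₁] k) := by
    rw [diagonal_inv_mul_mul_diagonal_apply, mul_sub, sub_mul, hs_rev]
  have hvi : Valued.v (![r₀⁻¹, r₁⁻¹] i) = 1 := by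
    fin_cases i
    · simpa using h0
    · simpa using h1
  have hvk : Valued.v (![r₀, r₁] k) = 1 := by
    fin_cases k
    · simpa using h0
    · simpa using h1
  rw [hconj, map_mul, map_mul, hvi, hvk, one_mul, mul_one]
  exact h i k

/-! ## §3 The pair heads: both members of a deep shell pair have the value `φ (a • 1)` -/

/-- **DEEP SHELL VALUE = CENTRAL VALUE.**  For any `φ` that is constant on the level-`j` cell around the scalar `a•1` (for a test function of level `j` this is right
`K(j)`-invariance), the value of `φ` at the shell-`m` conjugate of `γ = a + bτ` equals `φ (a•1)` as soon as the shell is deep (`|b ϖ^{−m}| ≤ |ϖ|^j`).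
[cite: LabesseLanglands1979, §2 (2.2) p. 9] [cite: Labesse2024StabilisationGermesSL2, Prop. 0.0.11] -/
theorem apply_shellConj_eq_apply_smul_one_of_deep {X : Type*} (φ : Matrix (Fin 2) (Fin 2) K → X) (ϖ : K) (j : ℕ) (a : K)
    (hφ : ∀ M : Matrix (Fin 2) (Fin 2) K, (∀ i k, Valued.v (M i k - (a • (1 : Matrix (Fin 2) (Fin 2) K)) i k) ≤ Valued.v ϖ ^ j) → φ M = φ (a • 1))
    (u v : K) (hu : Valued.v u ≤ 1) (hv : Valued.v v ≤ 1) (hϖ0 : ϖ ≠ 0) (hϖ : Valued.v ϖ ≤ 1) (m : ℕ) (b : K)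
    (hb : Valued.v (b * (ϖ ^ m)⁻¹) ≤ Valued.v ϖ ^ j) :
    φ !![a, b * v * ϖ ^ m; b * (ϖ ^ m)⁻¹, a + b * u] = φ (a • 1) :=
  hφ _ (forall_v_shellConj_sub_smul_one_le u v hu hv ϖ hϖ0 hϖ m j a b hb)

/-- **THE PARTNER'S DEEP SHELL VALUE = CENTRAL VALUE** (same `φ`, conjugated by a unit diagonal matrix `diag(r₀, r₁)`, `|r₀| = |r₁| = 1`).
[cite: LabesseLanglands1979, §2 (2.2) p. 9] [cite: Rogawski1990, §4.9 Lemma 4.9.3 p. 56] -/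
theorem apply_diagonal_conj_shellConj_eq_apply_smul_one_of_deep {X : Type*} (φ : Matrix (Fin 2) (Fin 2) K → X) (ϖ : K) (j : ℕ) (a : K)
    (hφ : ∀ M : Matrix (Fin 2) (Fin 2) K, (∀ i k, Valued.v (M i k - (a • (1 : Matrix (Fin 2) (Fin 2) K)) i k) ≤ Valued.v ϖ ^ j) → φ M = φ (a • 1))
    (r₀ r₁ : K) (h0 : Valued.v r₀ = 1) (h1 : Valued.v r₁ = 1)
    (u v : K) (hu : Valued.v u ≤ 1) (hv : Valued.v v ≤ 1) (hϖ0 : ϖ ≠ 0) (hϖ : Valued.v ϖ ≤ 1) (m : ℕ) (b : K)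
    (hb : Valued.v (b * (ϖ ^ m)⁻¹) ≤ Valued.v ϖ ^ j) :
    φ (Matrix.diagonal ![r₀⁻¹, r₁⁻¹] * !![a, b * v * ϖ ^ m; b * (ϖ ^ m)⁻¹, a + b * u] * Matrix.diagonal ![r₀, r₁]) = φ (a • 1) :=
  hφ _ (forall_v_diagonal_conj_sub_smul_one_le r₀ r₁ h0 h1 _ a _ (forall_v_shellConj_sub_smul_one_le u v hu hv ϖ hϖ0 hϖ m j a b hb))

/-- **(Ψ2) DEEP SHELLS VANISH IN `O(t) − O(e t)`.**  The shell-`m` PAIR difference — `φ` at the shell conjugate of `γ = a + bτ` minus `φ` at its outer twist by the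
unit diagonal `diag(r₀, r₁)` — is `0` on every deep shell (`|b ϖ^{−m}| ≤ |ϖ|^j`), for any `φ` constant on the level-`j` cell around `a•1` with values in an additive
group.  This is LL79 (2.2) ∕ Labesse 2024 Prop. 0.0.11 in the pair currency of the tree unfolding: conductor-free, valid at tame and wild ramified places alike.
[cite: LabesseLanglands1979, §2 (2.2) p. 9] [cite: Labesse2024StabilisationGermesSL2, Prop. 0.0.11, Th. 0.0.12] [cite: Rogawski1990, §4.9 Lemma 4.9.3 p. 56] -/
theorem apply_shellConj_sub_apply_diagonal_conj_shellConj_eq_zero_of_deep {X : Type*} [AddGroup X] (φ : Matrix (Fin 2) (Fin 2) K → X) (ϖ : K) (j : ℕ) (a : K)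
    (hφ : ∀ M : Matrix (Fin 2) (Fin 2) K, (∀ i k, Valued.v (M i k - (a • (1 : Matrix (Fin 2) (Fin 2) K)) i k) ≤ Valued.v ϖ ^ j) → φ M = φ (a • 1))
    (r₀ r₁ : K) (h0 : Valued.v r₀ = 1) (h1 : Valued.v r₁ = 1)
    (u v : K) (hu : Valued.v u ≤ 1) (hv : Valued.v v ≤ 1) (hϖ0 : ϖ ≠ 0) (hϖ : Valued.v ϖ ≤ 1) (m : ℕ) (b : K)
    (hb : Valued.v (b * (ϖ ^ m)⁻¹) ≤ Valued.v ϖ ^ j) :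
    φ !![a, b * v * ϖ ^ m; b * (ϖ ^ m)⁻¹, a + b * u] -
      φ (Matrix.diagonal ![r₀⁻¹, r₁⁻¹] * !![a, b * v * ϖ ^ m; b * (ϖ ^ m)⁻¹, a + b * u] * Matrix.diagonal ![r₀, r₁]) = 0 := by
  rw [apply_shellConj_eq_apply_smul_one_of_deep φ ϖ j a hφ u v hu hv hϖ0 hϖ m b hb,
    apply_diagonal_conj_shellConj_eq_apply_smul_one_of_deep φ ϖ j a hφ r₀ r₁ h0 h1 u v hu hv hϖ0 hϖ m b hb, sub_self]

/-- **(Ψ2), summed form.**  Over any finite set of DEEP shells the weighted pair differences sum to `0` (weights `w m`, e.g. the shell cardinalities `2q^m`):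
the deep part of the unfolded `O(t,φ) − O(e t,φ)` vanishes identically, leaving the window to (Ψ3). [cite: LabesseLanglands1979, §2 (2.2) p. 9]
[cite: Labesse2024StabilisationGermesSL2, Prop. 0.0.11, Th. 0.0.12] -/
theorem sum_smul_apply_shellConj_sub_eq_zero_of_deep {X : Type*} [AddCommGroup X] (φ : Matrix (Fin 2) (Fin 2) K → X) (ϖ : K) (j : ℕ) (a : K)
    (hφ : ∀ M : Matrix (Fin 2) (Fin 2) K, (∀ i k, Valued.v (M i k - (a • (1 : Matrix (Fin 2) (Fin 2) K)) i k) ≤ Valued.v ϖ ^ j) → φ M = φ (a • 1))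
    (r₀ r₁ : K) (h0 : Valued.v r₀ = 1) (h1 : Valued.v r₁ = 1)
    (u v : K) (hu : Valued.v u ≤ 1) (hv : Valued.v v ≤ 1) (hϖ0 : ϖ ≠ 0) (hϖ : Valued.v ϖ ≤ 1) (b : K)
    (S : Finset ℕ) (w : ℕ → ℤ) (hS : ∀ m ∈ S, Valued.v (b * (ϖ ^ m)⁻¹) ≤ Valued.v ϖ ^ j) :
    ∑ m ∈ S, w m • (φ !![a, b * v * ϖ ^ m; b * (ϖ ^ m)⁻¹, a + b * u] -
      φ (Matrix.diagonal ![r₀⁻¹, r₁⁻¹] * !![a, b * v * ϖ ^ m; b * (ϖ ^ m)⁻¹, a + b * u] * Matrix.diagonal ![r₀, r₁])) = 0 := by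
  refine Finset.sum_eq_zero fun m hm => ?_
  rw [apply_shellConj_sub_apply_diagonal_conj_shellConj_eq_zero_of_deep φ ϖ j a hφ r₀ r₁ h0 h1 u v hu hv hϖ0 hϖ m b (hS m hm), smul_zero]

end Valued

end Literature.NumberTheory.LocalFields.QuadraticRegularRep
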